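import Summits.QuantumFields.YangMills.Theorems.UnitScaleTiltProp7TubeStrSubStairLineIter
import Summits.QuantumFields.YangMills.Theorems.UnitScaleTiltProp7AxialGauge
import HarnessLib

/-!
# Route `UnitScaleTilt`, crux «MinimiserStabilityRegPr» (stmt-QuantumFields-19200, stub EX), γ-row `hGF[Lift]` (LOD line, ★p1 g24 LOCATE-L6-ASSEMBLY v1 §1 Step I.2),
# pen (L5) «LOCAL COMPARISON OF THE LOCAL TERMS», piece (L5c) (the `Q_k` term) — FILE A:
# ★★ THE CORNER TUBE FUNCTIONAL IS GAUGE COVARIANT, AND IN A GAUGE WHERE THE BACKGROUND IS `δ`-FLAT ALONG ITS WALKS IT IS THE PLAIN TUBE SUM UP TO `2(d+1)L^{K−n}δ`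

Cell `ym3-torus` (rung R3 — YM₃ on T³; NOT d = 4, NOT the Clay problem).  Width seat `ym-routeR-w4` g25 (CLAIM «MINE (L5)» HOME STATUS 2026-08-29 22:56Z, on ★p1 g24's
LOCATE-L6-ASSEMBLY v1 «HANDS WANTED (L5)»).  THEOREMS ONLY (0 `def`, 0 `sorry`); `--supports stmt-QuantumFields-19200 --as helper`; count-neutral.

THE POINT.  (L5c) compares `‖Q_k(U₀)A_j‖` with `‖Q_k(1)A_j^{g_j}‖` for a field `A_j` supported in a cube where the axial gauge `g_j` makes `U₀` `δ`-flat (`δ = 6R″ε₀η`).  By the knit rows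
(R1)–(R3) (✓p748544, ✓p746096, ✓p748472) `Q_k(U₀)A` is, for EVERY su(2) field and with NO locality, the framed corner tube functional `ℓ^{-d}·Ad_{Φ(c)}⁻¹T^{str}_{U₀}A(c)` up to
`O(ε₀)` in `ℓ²` (FILE B).  This file supplies the two local facts about `T^{str}` that turn this into (L5c): §1 the EXACT gauge covariance of a tube term
`Ad_{U(comb)·U(run)}X = Ad_{g(x₀)}⁻¹ Ad_{U^g(comb)·U^g(run)} Ad_{g(b₋)}X` (`U^g = gaugeActT g U`), and §2 the comparison with the plain tube sum when the transporter field is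
`δ`-close to `1` on the bonds of the walks that carry a nonzero value: per term `‖Ad_{H}X − X‖ ≤ 2(|comb| + t)δ‖X‖`, summed with Cauchy–Schwarz over the `ℓ^{d+1}` tube terms and the
exact multiplicity `ℓ` (✓`Prop7TubeStrSubStairLineIter.sq_sum_tube_le` ∕ `sum_tube_eq`): `Σ_c ‖T_V Y(c) − Σ_{tube(c)} Y‖² ≤ (2(d+1)ℓδ)²·ℓ^dℓ²·Σ_b‖Y b‖²`; §3 the plain tube sum IS
`ℓ^d • QTwS 1 Y` (✓`tubeStr_one_eq_smul_QTwS_one`).  The hypothesis is the weakest the proof uses — a bound on the bonds of the comb∕run walks of the terms with `Y ≠ 0` — so that the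
(L6) assembler discharges it from «`supp A_j ⊂ □_j`, `g_j` axial on `□̃_j`» in its own cube letters.
HONEST SCOPE.  Bookkeeping over landed rows; the `ℓ²` combination with the knit rows ((L5c) proper) is FILE B; (L5a)∕(L5b), (L5″), (L6), the seams, `hGF`, the print rows, `hThm2S`, EX and the
crux are NOT proved here.
References: T. Bałaban, CMP **99** (1985) 389–434 [Balaban1985BackgroundPropagators] ((3.4)–(3.5) p.391, (3.13)–(3.15) p.393, Thm 3.11 p.416); CMP **98** (1985) 17–51
[Balaban1985Averaging] ((8)–(11) pp.18–19, (19)–(20) p.21); CMP **95** (1984) 17–40 [Balaban1984PropagatorsI] ((1.18) p.20); CMP **99** (1985) 75–102 [Balaban1985RegularSpaces]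
(Lemma 1 (1.25) p.79).
-/

set_option autoImplicit false

noncomputable section

open scoped BigOperators Matrix.Norms.L2Operator Matrix

namespace Summit.QuantumFields.YangMills.Theorems.Prop7TubeStrGaugeComparison

open Literature.MathematicalPhysics.QuantumFieldTheory.Balaban1983to89
open Literature.MathematicalPhysics.QuantumFieldTheory.Balaban1983to89.T3ContinuumYM3Torus
open Finset T4Continuum BlockAveraging BlockAveragingEMLLinearised BlockAveragingEMLLinearisedBackground LatticeFieldCalculus
open B1RG242Torus
open B5Eq118OneStroke (iterBlockOf)
open B7Prop1Explicit (U1 mem_U1 treeWord l1 length_treeWord disp)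
open B7Prop2Explicit (unitaryUnits unitaryUnits_le_U1)
open B7Eq78Linearization (conjR conjR_apply conjR_sub)
open B8Ineq132 (norm_conjR conjR_conjR one_conjR conjR_sum)
open B10Eq27TorusAxialLog (holT gaugeActT gaugeActT_apply unitsField toUField holT_one transl rel)
open T3LevelShift (bondShift)
open T3PrintedRegularOrbits (sites_eq)
open T3PrintedRegularMinimiser (unitsField_toUField_one)
open Summit.QuantumFields.YangMills.Theorems.Prop7SymAvgTwSym (QTwS unitsField_toUField_mem_U1')
open Summit.QuantumFields.YangMills.Theorems.Prop7NestedMeanTowerCloseness (norm_holT_sub_one_le_of_walk rel_corner_fibreSite)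
open Summit.QuantumFields.YangMills.Theorems.Prop7CovariantCoercivity (norm_conjR_sub_conjR_le)
open Summit.QuantumFields.YangMills.Theorems.Prop7TubeTransportCloseness (walkEnd_replicate_true)
open Summit.QuantumFields.YangMills.Theorems.Prop7TubeStrSubStairLineIter (sum_tube_eq sq_sum_tube_le)
open Summit.QuantumFields.YangMills.Theorems.Prop7TubeComparisonRowFlat (tubeStr_one_eq_smul_QTwS_one)

/-! ## §1 Gauge covariance of a tube term (exact) and the per-term defect against the plain term -/

section Generic

variable {P : Params} {j : ℕ}

/-- ★ **GAUGE COVARIANCE OF A TUBE TERM** ((3.4)–(3.5): `R(g)` acts on vector fields by `Ad_{g(b₋)}`): for a transporter field `U`, a gauge transformation `g`, a comb `w₁` from `x₀` and a run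
`w₂` from its end `x₁`, ending at `x₂`:  `Ad_{U(w₁)U(w₂)} X = Ad_{g(x₀)}⁻¹·Ad_{U^g(w₁)U^g(w₂)}·Ad_{g(x₂)} X` with `U^g = gaugeActT g U` (`U^g(w) = g(start)·U(w)·g(end)⁻¹`,
✓`holT_gaugeActT`). [cite: Balaban1985BackgroundPropagators, (3.4)-(3.5) p.391; Balaban1985Averaging, (8)-(9) pp.18-19] -/
theorem conjR_holT_mul_holT_eq_gauge (U : GaugeField P j ((Matrix (Fin 2) (Fin 2) ℂ))ˣ) (g : GaugeTransf P j ((Matrix (Fin 2) (Fin 2) ℂ))ˣ) (x₀ : Site P j)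
    (w₁ w₂ : List (B7Prop1Explicit.Letter P.d)) (X : Matrix (Fin 2) (Fin 2) ℂ) :
    conjR (holT U x₀ w₁ * holT U (transl x₀ (disp w₁)) w₂) X
      = conjR (g x₀)⁻¹ (conjR (holT (gaugeActT g U) x₀ w₁ * holT (gaugeActT g U) (transl x₀ (disp w₁)) w₂)
          (conjR (g (transl (transl x₀ (disp w₁)) (disp w₂))) X)) := by
  rw [Prop7AxialGauge.holT_gaugeActT, Prop7AxialGauge.holT_gaugeActT, conjR_conjR, conjR_conjR]
  congr 1
  group

/-- ★ **THE PER-TERM DEFECT AGAINST THE PLAIN TERM**: if the transporter field `V` is contractive (`U1`-valued) and `δ`-close to `1` on every bond of the comb `w₁` from `x₀` and of the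
run `w₂` from `x₁ = x₀ + disp w₁`, then `‖Ad_{V(w₁)V(w₂)} X − X‖ ≤ 2(|w₁| + |w₂|)δ‖X‖` (holonomies telescope: ✓`norm_holT_sub_one_le_of_walk`; `Ad` is 2-Lipschitz on `U1`).
[cite: Balaban1985Averaging, (11) p.19, (19)-(20) p.21] -/
theorem norm_conjR_holT_mul_holT_sub_le (V : GaugeField P j ((Matrix (Fin 2) (Fin 2) ℂ))ˣ) (hV : ∀ b, V b ∈ U1 (Matrix (Fin 2) (Fin 2) ℂ)) {δ : ℝ} (hδ : 0 ≤ δ) (x₀ : Site P j)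
    (w₁ w₂ : List (B7Prop1Explicit.Letter P.d))
    (h₁ : ∀ st ∈ walk x₀ w₁, ‖((V st.bond : (Matrix (Fin 2) (Fin 2) ℂ)ˣ) : Matrix (Fin 2) (Fin 2) ℂ) - 1‖ ≤ δ)
    (h₂ : ∀ st ∈ walk (transl x₀ (disp w₁)) w₂, ‖((V st.bond : (Matrix (Fin 2) (Fin 2) ℂ)ˣ) : Matrix (Fin 2) (Fin 2) ℂ) - 1‖ ≤ δ) (X : Matrix (Fin 2) (Fin 2) ℂ) :
    ‖conjR (holT V x₀ w₁ * holT V (transl x₀ (disp w₁)) w₂) X - X‖ ≤ 2 * ((w₁.length + w₂.length) * δ) * ‖X‖ := by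
  set a : (Matrix (Fin 2) (Fin 2) ℂ)ˣ := holT V x₀ w₁ with ha
  set b : (Matrix (Fin 2) (Fin 2) ℂ)ˣ := holT V (transl x₀ (disp w₁)) w₂ with hb
  have ha1 : ‖(a : Matrix (Fin 2) (Fin 2) ℂ) - 1‖ ≤ w₁.length * δ := norm_holT_sub_one_le_of_walk V hV hδ w₁ x₀ h₁
  have hb1 : ‖(b : Matrix (Fin 2) (Fin 2) ℂ) - 1‖ ≤ w₂.length * δ := norm_holT_sub_one_le_of_walk V hV hδ w₂ _ h₂
  have haU : a ∈ U1 (Matrix (Fin 2) (Fin 2) ℂ) := Prop7SymAvgTwSym.holT_mem_U1 hV _ _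
  have hbU : b ∈ U1 (Matrix (Fin 2) (Fin 2) ℂ) := Prop7SymAvgTwSym.holT_mem_U1 hV _ _
  have habU : a * b ∈ U1 (Matrix (Fin 2) (Fin 2) ℂ) := (U1 _).mul_mem haU hbU
  -- `‖ab − 1‖ ≤ ‖a − 1‖‖b‖ + ‖b − 1‖ ≤ ‖a − 1‖ + ‖b − 1‖`
  have hab1 : ‖((a * b : (Matrix (Fin 2) (Fin 2) ℂ)ˣ) : Matrix (Fin 2) (Fin 2) ℂ) - 1‖ ≤ (w₁.length + w₂.length) * δ := by
    have hid : ((a * b : (Matrix (Fin 2) (Fin 2) ℂ)ˣ) : Matrix (Fin 2) (Fin 2) ℂ) - 1 = ((a : Matrix (Fin 2) (Fin 2) ℂ) - 1) * (b : Matrix (Fin 2) (Fin 2) ℂ) + ((b : Matrix (Fin 2) (Fin 2) ℂ) - 1) := by rw [Units.val_mul]; noncomm_ring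
    rw [hid]
    calc _ ≤ ‖((a : Matrix (Fin 2) (Fin 2) ℂ) - 1) * (b : Matrix (Fin 2) (Fin 2) ℂ)‖ + ‖(b : Matrix (Fin 2) (Fin 2) ℂ) - 1‖ := norm_add_le _ _
      _ ≤ ‖(a : Matrix (Fin 2) (Fin 2) ℂ) - 1‖ * ‖(b : Matrix (Fin 2) (Fin 2) ℂ)‖ + ‖(b : Matrix (Fin 2) (Fin 2) ℂ) - 1‖ := by gcongr; exact norm_mul_le _ _
      _ ≤ w₁.length * δ * 1 + w₂.length * δ := by
          gcongr
          · exact (mem_U1.1 hbU).1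
      _ = (w₁.length + w₂.length) * δ := by ring
  have h := norm_conjR_sub_conjR_le (U1 (Matrix (Fin 2) (Fin 2) ℂ)).one_mem habU X
  rw [one_conjR, Units.val_one] at h
  calc ‖conjR (a * b) X - X‖ ≤ 2 * ‖((a * b : (Matrix (Fin 2) (Fin 2) ℂ)ˣ) : Matrix (Fin 2) (Fin 2) ℂ) - 1‖ * ‖X‖ := h
    _ ≤ 2 * ((w₁.length + w₂.length) * δ) * ‖X‖ := by gcongr

end Generic

/-! ## §2 The corner tube functional of a `δ`-flat transporter field against the plain tube sum, summed over the top bonds -/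

variable (F : T3Family) {n K : ℕ}

/-- The comb word of the offset `r` from the block corner has `Σ_ν r_ν ≤ d(L^{K−n} − 1)` letters. [cite: Balaban1985Averaging, (9) p.18] -/
theorem length_treeWord_offset_le (r : Fin (F.P K).d → Fin ((F.P K).L ^ (K - n))) :
    ((treeWord fun ν => ((r ν : ℕ) : ℤ)).length : ℝ) ≤ (F.P K).d * ((F.L : ℝ) ^ (K - n) - 1) := by
  rw [length_treeWord]
  unfold l1
  have h2 : (∑ κ : Fin (F.P K).d, ((fun ν => ((r ν : ℕ) : ℤ)) κ).natAbs) ≤ (F.P K).d * ((F.P K).L ^ (K - n) - 1) := by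
    calc _ ≤ ∑ _κ : Fin (F.P K).d, ((F.P K).L ^ (K - n) - 1) := Finset.sum_le_sum fun κ _ => by
            show (((r κ : ℕ) : ℤ)).natAbs ≤ _
            rw [Int.natAbs_natCast]; have := (r κ).isLt; omega
      _ = _ := by rw [Finset.sum_const, Finset.card_univ, Fintype.card_fin, smul_eq_mul]
  have hL1 : 1 ≤ (F.P K).L ^ (K - n) := Nat.one_le_pow _ _ (F.P K).L_pos
  have h3 := (Nat.cast_le (α := ℝ)).mpr h2
  rw [Nat.cast_mul, Nat.cast_sub hL1, Nat.cast_pow, Nat.cast_one] at h3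
  exact h3

/-- ★★ **A `δ`-FLAT TRANSPORTER FIELD: THE CORNER TUBE FUNCTIONAL IS THE PLAIN TUBE SUM UP TO `2(d+1)ℓδ`, IN `ℓ²` OVER THE TOP BONDS** (`ℓ = L^{K−n}`).  `V` contractive; for every
top bond `c`, offset `r` and `t < ℓ` with `Y(x_r + te_μ, μ) ≠ 0`, every bond of the comb `x₀(c) → x_r` and of the run `x_r → x_r + te_μ` is `δ`-close to `1` under `V` (the weakest
hypothesis the proof uses; the (L6) assembler gets it from «`supp Y ⊂ □`, `V = U₀^g` with `g` axial on the concentric `□̃`»).  Then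
`Σ_c ‖Σ_rΣ_{t<ℓ} Ad_{V(comb)V(run)} Y(b_{r,t}) − Σ_rΣ_{t<ℓ} Y(b_{r,t})‖² ≤ (2(d+1)ℓδ)²·(ℓ^d·ℓ²)·Σ_b‖Y b‖²` (per term §1, `|comb| + t ≤ (d+1)ℓ`; Cauchy–Schwarz over the
`ℓ^{d+1}` terms; multiplicity `ℓ`). [cite: Balaban1985Averaging, (11) p.19, (19)-(20) p.21; Balaban1984PropagatorsI, (1.18) p.20] -/
theorem sum_normSq_tubeStr_sub_plain_le (V : GaugeField (F.P K) 0 ((Matrix (Fin 2) (Fin 2) ℂ))ˣ) (hV : ∀ b, V b ∈ U1 (Matrix (Fin 2) (Fin 2) ℂ)) {δ : ℝ} (hδ : 0 ≤ δ)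
    (Y : PBond (F.P K) 0 → Matrix (Fin 2) (Fin 2) ℂ)
    (hgood : ∀ (c : PBond (F.P K) (K - n)) (r : Fin (F.P K).d → Fin ((F.P K).L ^ (K - n))) (t : ℕ), t < (F.P K).L ^ (K - n) →
      Y ⟨(fun z : Site (F.P K) 0 => z.shift c.dir)^[t] (Site.fibreSite 0 (K - n) c.src r), c.dir⟩ ≠ 0 →
        (∀ st ∈ walk (Site.fibreSite 0 (K - n) c.src fun _ => (⟨0, pow_pos (F.P K).L_pos (K - n)⟩ : Fin ((F.P K).L ^ (K - n)))) (treeWord fun ν => ((r ν : ℕ) : ℤ)), ‖((V st.bond : (Matrix (Fin 2) (Fin 2) ℂ)ˣ) : Matrix (Fin 2) (Fin 2) ℂ) - 1‖ ≤ δ) ∧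
        (∀ st ∈ walk (Site.fibreSite 0 (K - n) c.src r) (List.replicate t (c.dir, true)), ‖((V st.bond : (Matrix (Fin 2) (Fin 2) ℂ)ˣ) : Matrix (Fin 2) (Fin 2) ℂ) - 1‖ ≤ δ)) :
    ∑ c : PBond (F.P K) (K - n),
      ‖(∑ r : Fin (F.P K).d → Fin ((F.P K).L ^ (K - n)), ∑ t ∈ Finset.range ((F.P K).L ^ (K - n)),
          conjR (holT V (Site.fibreSite 0 (K - n) c.src fun _ => (⟨0, pow_pos (F.P K).L_pos (K - n)⟩ : Fin ((F.P K).L ^ (K - n)))) (treeWord fun ν => ((r ν : ℕ) : ℤ))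
              * holT V (Site.fibreSite 0 (K - n) c.src r) (List.replicate t (c.dir, true)))
            (Y ⟨(fun z : Site (F.P K) 0 => z.shift c.dir)^[t] (Site.fibreSite 0 (K - n) c.src r), c.dir⟩))
        - ∑ r : Fin (F.P K).d → Fin ((F.P K).L ^ (K - n)), ∑ t ∈ Finset.range ((F.P K).L ^ (K - n)),
            Y ⟨(fun z : Site (F.P K) 0 => z.shift c.dir)^[t] (Site.fibreSite 0 (K - n) c.src r), c.dir⟩‖ ^ 2
      ≤ (2 * (((F.P K).d + 1) * (F.L : ℝ) ^ (K - n)) * δ) ^ 2 * ((((F.L : ℝ) ^ (K - n)) ^ (F.P K).d) * (((F.L : ℝ) ^ (K - n)) ^ 2))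
          * ∑ b : PBond (F.P K) 0, ‖Y b‖ ^ 2 := by
  have hk : K - n ≤ (F.P K).m + (F.P K).K := by show K - n ≤ F.m + K; omega
  have hLL : ((F.P K).L : ℝ) = F.L := rfl
  have hL1 : (1 : ℝ) ≤ (F.L : ℝ) ^ (K - n) := by
    have h3 : 3 ≤ F.L := by obtain ⟨a, ha⟩ := F.hL.1; have := F.hL.2; omega
    exact one_le_pow₀ (by exact_mod_cast (show 1 ≤ F.L by omega))
  set C : ℝ := 2 * (((F.P K).d + 1) * (F.L : ℝ) ^ (K - n)) * δ with hC
  have hC0 : 0 ≤ C := by rw [hC]; positivity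
  -- the comb of `r` ends at `x_r`
  have hend : ∀ (c : PBond (F.P K) (K - n)) (r : Fin (F.P K).d → Fin ((F.P K).L ^ (K - n))),
      transl (Site.fibreSite 0 (K - n) c.src fun _ => (⟨0, pow_pos (F.P K).L_pos (K - n)⟩ : Fin ((F.P K).L ^ (K - n)))) (disp (treeWord fun ν => ((r ν : ℕ) : ℤ))) = Site.fibreSite 0 (K - n) c.src r := by
    intro c r
    rw [← rel_corner_fibreSite hk c.src (pow_pos (F.P K).L_pos (K - n)) r, B10Eq27TorusAxialLog.transl_disp_treeWord_rel]
  -- ★ per `c`: the tube defect is `C·Σ_rΣ_t ‖Y b_{r,t}‖`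
  have hc : ∀ c : PBond (F.P K) (K - n),
      ‖(∑ r : Fin (F.P K).d → Fin ((F.P K).L ^ (K - n)), ∑ t ∈ Finset.range ((F.P K).L ^ (K - n)),
          conjR (holT V (Site.fibreSite 0 (K - n) c.src fun _ => (⟨0, pow_pos (F.P K).L_pos (K - n)⟩ : Fin ((F.P K).L ^ (K - n)))) (treeWord fun ν => ((r ν : ℕ) : ℤ))
              * holT V (Site.fibreSite 0 (K - n) c.src r) (List.replicate t (c.dir, true)))
            (Y ⟨(fun z : Site (F.P K) 0 => z.shift c.dir)^[t] (Site.fibreSite 0 (K - n) c.src r), c.dir⟩))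
        - ∑ r : Fin (F.P K).d → Fin ((F.P K).L ^ (K - n)), ∑ t ∈ Finset.range ((F.P K).L ^ (K - n)),
            Y ⟨(fun z : Site (F.P K) 0 => z.shift c.dir)^[t] (Site.fibreSite 0 (K - n) c.src r), c.dir⟩‖
      ≤ C * ∑ r : Fin (F.P K).d → Fin ((F.P K).L ^ (K - n)), ∑ t ∈ Finset.range ((F.P K).L ^ (K - n)),
          ‖Y ⟨(fun z : Site (F.P K) 0 => z.shift c.dir)^[t] (Site.fibreSite 0 (K - n) c.src r), c.dir⟩‖ := by
    intro c
    simp only [← Finset.sum_sub_distrib]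
    refine (norm_sum_le _ _).trans ?_
    rw [Finset.mul_sum]
    refine Finset.sum_le_sum fun r _ => (norm_sum_le _ _).trans ?_
    rw [Finset.mul_sum]
    refine Finset.sum_le_sum fun t ht => ?_
    have htℓ : t < (F.P K).L ^ (K - n) := Finset.mem_range.mp ht
    set X := Y ⟨(fun z : Site (F.P K) 0 => z.shift c.dir)^[t] (Site.fibreSite 0 (K - n) c.src r), c.dir⟩ with hX
    by_cases hX0 : X = 0
    · rw [hX0, norm_zero, mul_zero, conjR_apply, mul_zero, zero_mul, sub_zero, norm_zero]
    obtain ⟨h₁, h₂⟩ := hgood c r t htℓ hX0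
    have h₂' : ∀ st ∈ walk (transl (Site.fibreSite 0 (K - n) c.src fun _ => (⟨0, pow_pos (F.P K).L_pos (K - n)⟩ : Fin ((F.P K).L ^ (K - n)))) (disp (treeWord fun ν => ((r ν : ℕ) : ℤ)))) (List.replicate t (c.dir, true)),
        ‖((V st.bond : (Matrix (Fin 2) (Fin 2) ℂ)ˣ) : Matrix (Fin 2) (Fin 2) ℂ) - 1‖ ≤ δ := by rw [hend c r]; exact h₂
    have hmain := norm_conjR_holT_mul_holT_sub_le V hV hδ (Site.fibreSite 0 (K - n) c.src fun _ => (⟨0, pow_pos (F.P K).L_pos (K - n)⟩ : Fin ((F.P K).L ^ (K - n)))) (treeWord fun ν => ((r ν : ℕ) : ℤ)) (List.replicate t (c.dir, true)) h₁ h₂' X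
    rw [hend c r] at hmain
    refine hmain.trans (mul_le_mul_of_nonneg_right ?_ (norm_nonneg X))
    -- `2(|comb| + t)δ ≤ C`
    rw [hC, List.length_replicate]
    have hlen := length_treeWord_offset_le F (n := n) (K := K) r
    have ht' : (t : ℝ) ≤ (F.L : ℝ) ^ (K - n) - 1 := by
      have h1 : t + 1 ≤ (F.P K).L ^ (K - n) := htℓ
      have h2 : ((t + 1 : ℕ) : ℝ) ≤ (((F.P K).L ^ (K - n) : ℕ) : ℝ) := by exact_mod_cast h1
      push_cast at h2; rw [hLL] at h2; linarith
    have hd0 : (0 : ℝ) ≤ (F.P K).d := Nat.cast_nonneg _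
    nlinarith [hlen, ht', hd0, hδ, hL1]
  -- ★ square, Cauchy–Schwarz over the tube, exact multiplicity
  calc _ ≤ ∑ c : PBond (F.P K) (K - n), (C * ∑ r : Fin (F.P K).d → Fin ((F.P K).L ^ (K - n)), ∑ t ∈ Finset.range ((F.P K).L ^ (K - n)),
          ‖Y ⟨(fun z : Site (F.P K) 0 => z.shift c.dir)^[t] (Site.fibreSite 0 (K - n) c.src r), c.dir⟩‖) ^ 2 :=
        Finset.sum_le_sum fun c _ => pow_le_pow_left₀ (norm_nonneg _) (hc c) 2
    _ ≤ ∑ c : PBond (F.P K) (K - n), C ^ 2 * ((((F.L : ℝ) ^ (K - n)) ^ (F.P K).d * (F.L : ℝ) ^ (K - n))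
          * ∑ r : Fin (F.P K).d → Fin ((F.P K).L ^ (K - n)), ∑ t ∈ Finset.range ((F.P K).L ^ (K - n)),
              ‖Y ⟨(fun z : Site (F.P K) 0 => z.shift c.dir)^[t] (Site.fibreSite 0 (K - n) c.src r), c.dir⟩‖ ^ 2) := by
        refine Finset.sum_le_sum fun c _ => ?_
        rw [mul_pow]
        refine mul_le_mul_of_nonneg_left ?_ (sq_nonneg _)
        have h := sq_sum_tube_le (P := F.P K) (k := K - n) (fun r t => ‖Y ⟨(fun z : Site (F.P K) 0 => z.shift c.dir)^[t] (Site.fibreSite 0 (K - n) c.src r), c.dir⟩‖)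
        rw [hLL] at h
        exact h
    _ = C ^ 2 * ((((F.L : ℝ) ^ (K - n)) ^ (F.P K).d * (F.L : ℝ) ^ (K - n))
          * ((F.L : ℝ) ^ (K - n) * ∑ b : PBond (F.P K) 0, ‖Y b‖ ^ 2)) := by
        rw [← Finset.mul_sum, ← Finset.mul_sum]
        have h := sum_tube_eq (P := F.P K) (k := K - n) hk (fun b => ‖Y b‖ ^ 2)
        rw [hLL] at h
        rw [h]
    _ = _ := by rw [hC]; ring

/-! ## §3 The plain tube sum is `ℓ^d • QTwS 1` -/

variable (n K) (h : n ≤ K)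

/-- **THE PLAIN TUBE SUM IS `ℓ^d` TIMES THE AVERAGING OPERATOR OF RECORD AT THE TRIVIAL BACKGROUND**: `Σ_rΣ_{t<ℓ} Y(b_{r,t}(ĉ)) = (ℓ^d : ℂ) • QTwS F n K h 1 Y c`
(`ĉ = bondShift (sites_eq F n K h) c`; ✓`tubeStr_one_eq_smul_QTwS_one` with its trivial transporters erased). [cite: Balaban1984PropagatorsI, (1.18) p.20; Balaban1985Averaging, (125)-(127) p.36] -/
theorem plainTube_eq_smul_QTwS_one (Y : PBond (F.P K) 0 → Matrix (Fin 2) (Fin 2) ℂ) (c : PBond (F.P n) 0) :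
    ∑ r : Fin (F.P K).d → Fin ((F.P K).L ^ (K - n)), ∑ t ∈ Finset.range ((F.P K).L ^ (K - n)),
        Y ⟨(fun z : Site (F.P K) 0 => z.shift (bondShift (sites_eq F n K h) c).dir)^[t]
              (Site.fibreSite 0 (K - n) (bondShift (sites_eq F n K h) c).src r), (bondShift (sites_eq F n K h) c).dir⟩
      = ((((F.P K).L : ℂ) ^ (K - n)) ^ (F.P K).d) • QTwS F n K h (1 : GaugeField (F.P K) 0 (Matrix.specialUnitaryGroup (Fin 2) ℂ)) Y c := by
  have h1 := tubeStr_one_eq_smul_QTwS_one F n K h Y c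
  simp only [unitsField_toUField_one, holT_one, one_mul, one_conjR] at h1
  exact h1

end Summit.QuantumFields.YangMills.Theorems.Prop7TubeStrGaugeComparison

end
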